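import Literature.NumberTheory.LFunctions.ClassicalZeroFreeRegion
import Literature.NumberTheory.LFunctions.ZetaOneLineBounds
import Literature.NumberTheory.LFunctions.RHWave0
import Mathlib.NumberTheory.LSeries.Dirichlet
import HarnessLib

/-!
# The classical zero-free region for `ζ` (de la Vallée Poussin 1899): rh.S09 proved

Topic `Literature/NumberTheory/LFunctions`. Everything in this file is PROVED; it discharges the
named fact `Literature.NumberTheory.LFunctions.zero_free_region_classical` (rh.S09) of `RHWave0.lean`:

> there is an absolute constant `c > 0` such that `ζ(σ + it) ≠ 0` whenever `|t| ≥ 2` and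
> `σ ≥ 1 − c/log|t|` (de la Vallée Poussin 1899; Montgomery–Vaughan Theorem 6.6;
> Titchmarsh Theorem 3.8).

The proof is the specialisation to `ζ` of the abstract de la Vallée-Poussin–Landau argument
`Literature.NumberTheory.LFunctions.ClassicalZFRData.zeroFree` (`ClassicalZeroFreeRegion.lean`, Montgomery–Vaughan §6.1), with

* `Λ` = von Mangoldt's function (Mathlib `ArithmeticFunction.vonMangoldt`: `Λ ≥ 0`, `Λ(1) = 0`,
  `∑ Λ(n) n^{-s}` absolutely convergent for `σ > 1`, `= −ζ'/ζ(s)` there —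
  `ArithmeticFunction.LSeries_vonMangoldt_eq_deriv_riemannZeta_div`);
* `G = riemannZeta₁`, Mathlib's entire function with `G(s) = (s − 1)ζ(s)` off `s = 1` and
  `G(1) = 1` (`riemannZeta_eq_inv_sub_mul`, `riemannZeta₁_one`, `differentiable_riemannZeta₁`);
* `η = 1/2`, the growth hypothesis `|G(s)| ≤ 3(|t| + 4)²` on `1/2 < σ ≤ 3` being Titchmarsh's
  (2.12.2) in the explicit form `‖ζ₁(s)‖ ≤ ‖s‖ + ‖s‖‖s − 1‖/σ` (`σ > 0`) proved in
  `ZetaFractionalPartIntegral.lean` (`Literature.NumberTheory.LFunctions.norm_riemannZeta₁_le_of_re_pos`).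

`ClassicalZFRData.zeroFree` then gives `c₀ > 0` with `ζ₁(s) ≠ 0` for `σ > 1/2`,
`σ > 1 − c₀/log(|t| + 4)`; since `log(|t| + 4) < 3 log|t|` for `|t| ≥ 2` (`|t| + 4 < |t|³`), the
constant `c = min(c₀/3, (log 2)/4)` works in the coordinates of rh.S09 (the second term keeps the
region inside `σ ≥ 3/4 > 1/2`). The same specialisation of `ClassicalZFRData.norm_logDeriv_le`
(Montgomery–Vaughan Theorem 6.7) gives the companion bound `|ζ'/ζ(σ + it)| ≤ C log|t|` in the
region (`Literature.NumberTheory.LFunctions.exists_norm_logDeriv_riemannZeta_le`), the input of the de la Vallée Poussin error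
term in the prime number theorem.

The explicit form of rh.S09 with `c = 1/5.558691` (Mossinghoff–Trudgian–Yang 2024, Theorem 1.3;
`Literature.NumberTheory.LFunctions.zero_free_region_mossinghoff_trudgian_yang`) is NOT obtained this way: the constant
produced by the Landau–Titchmarsh local method is far smaller, and the printed proof of the explicit
constant rests on the numerical verification of RH to height `3·10¹²` (the reduction of that
theorem to the two ingredients of its printed proof is the planned companion file
`ExplicitZeroFreeRegion.lean`, proposed alongside this one).

The elementary facts about `ζ₁` used below (`ζ₁(s) = (s − 1)ζ(s)` and `ζ₁(s) = 0 ↔ ζ(s) = 0` off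
`s = 1`, `ζ₁' = ζ + (s − 1)ζ'`, `ζ'/ζ = ζ₁'/ζ₁ − 1/(s − 1)`) are the tree's
`Literature.NumberTheory.LFunctions.riemannZeta₁_eq_mul`, `Literature.NumberTheory.LFunctions.riemannZeta₁_eq_zero_iff`, `Literature.NumberTheory.LFunctions.logDeriv_riemannZeta_eq`
(`ZetaLogDerivDisc.lean`) and `Literature.NumberTheory.LFunctions.ZetaOneLine.deriv_riemannZeta₁_eq`,
`Literature.NumberTheory.LFunctions.ZetaOneLine.riemannZeta₁_ne_zero_of_one_le_re` (`ZetaOneLineBounds.lean`).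

## References

* Ch.-J. de la Vallée Poussin, *Sur la fonction ζ(s) de Riemann et le nombre des nombres premiers
  inférieurs à une limite donnée*, Mém. Couronnés Acad. Roy. Belgique 59 (1899) (`Poussin1899`).
* H. L. Montgomery, R. C. Vaughan, *Multiplicative Number Theory I. Classical Theory*, Cambridge
  Stud. Adv. Math. 97 (2007), §6.1, Theorems 6.6 and 6.7 (`MontgomeryVaughan2007`).
* E. C. Titchmarsh, *The Theory of the Riemann Zeta-Function*, 2nd ed. (1986), §2.12 (2.12.2),
  §3.8 Theorem 3.8, §3.9 Lemma α (`Titchmarsh1986`).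
-/

noncomputable section

open Complex

namespace Literature.NumberTheory.LFunctions

/-! ## `ζ₁ = (s − 1)ζ(s)` on `σ > 1` -/

/-- On `σ > 1`: `ζ₁'/ζ₁(s) = 1/(s − 1) − ∑ Λ(n) n^{-s}` (from `ζ₁' = ζ + (s − 1)ζ'`,
`Literature.NumberTheory.LFunctions.ZetaOneLine.deriv_riemannZeta₁_eq`, and `−ζ'/ζ = ∑ Λ n^{-s}`, Mathlib
`ArithmeticFunction.LSeries_vonMangoldt_eq_deriv_riemannZeta_div`).
[cite: MontgomeryVaughan2007, §6.1 (proof of Theorem 6.6)] -/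
theorem deriv_riemannZeta₁_div_eq {s : ℂ} (hs : 1 < s.re) :
    deriv riemannZeta₁ s / riemannZeta₁ s =
      1 / (s - 1) - LSeries (fun n ↦ (ArithmeticFunction.vonMangoldt n : ℂ)) s := by
  have hs1 : s ≠ 1 := by
    rintro rfl
    simp at hs
  have hs1' : s - 1 ≠ 0 := sub_ne_zero.mpr hs1
  have hζ : riemannZeta s ≠ 0 := riemannZeta_ne_zero_of_one_lt_re hs
  have hL : LSeries (fun n ↦ (ArithmeticFunction.vonMangoldt n : ℂ)) s =
      -deriv riemannZeta s / riemannZeta s :=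
    ArithmeticFunction.LSeries_vonMangoldt_eq_deriv_riemannZeta_div hs
  rw [ZetaOneLine.deriv_riemannZeta₁_eq hs1, riemannZeta₁_eq_mul hs1, hL]
  field_simp
  ring

/-! ## The hypotheses of the classical argument hold for `ζ` -/

/-- **`ζ` satisfies the hypotheses of the de la Vallée-Poussin–Landau argument**
(`Literature.NumberTheory.LFunctions.ClassicalZFRData`) with `Λ` = von Mangoldt's function, `G = ζ₁ = (s − 1)ζ(s)` (entire,
`ζ₁(1) = 1`) and `η = 1/2`; the growth bound `|ζ₁(s)| ≤ 3(|t| + 4)²` on `1/2 < σ ≤ 3` is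
Titchmarsh (2.12.2). [cite: MontgomeryVaughan2007, §6.1 Theorem 6.6]
[cite: Titchmarsh1986, §2.12 eq. (2.12.2)] -/
theorem classicalZFRData_riemannZeta :
    ClassicalZFRData (fun n ↦ ArithmeticFunction.vonMangoldt n) riemannZeta₁ (1 / 2) where
  eta_pos := by norm_num
  eta_le_one := by norm_num
  nonneg _ := ArithmeticFunction.vonMangoldt_nonneg
  map_one := ArithmeticFunction.vonMangoldt_apply_one
  summable _ hs := ArithmeticFunction.LSeriesSummable_vonMangoldt hs
  differentiableOn := differentiable_riemannZeta₁.differentiableOn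
  ne_zero _ hs := ZetaOneLine.riemannZeta₁_ne_zero_of_one_le_re hs.le
  logDeriv_eq _ hs := deriv_riemannZeta₁_div_eq hs
  map_one_ne := by
    rw [riemannZeta₁_one]
    exact one_ne_zero
  growth := by
    refine ⟨2, 3, by norm_num, fun s hs hs3 ↦ ?_⟩
    have hσ : 0 < s.re := by linarith
    have hτ : 4 ≤ |s.im| + 4 := by linarith [abs_nonneg s.im]
    have hns : ‖s‖ ≤ |s.im| + 4 := by
      have h1 := Complex.norm_le_abs_re_add_abs_im s
      have h2 : |s.re| ≤ 3 := abs_le.mpr ⟨by linarith, hs3⟩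
      linarith
    have hns1 : ‖s - 1‖ ≤ |s.im| + 4 := by
      have h1 := Complex.norm_le_abs_re_add_abs_im (s - 1)
      simp only [Complex.sub_re, Complex.one_re, Complex.sub_im, Complex.one_im, sub_zero] at h1
      have h2 : |s.re - 1| ≤ 3 := abs_le.mpr ⟨by linarith, by linarith⟩
      linarith
    have hmain := norm_riemannZeta₁_le_of_re_pos hσ
    have hdiv : ‖s‖ * ‖s - 1‖ / s.re ≤ 2 * ((|s.im| + 4) * (|s.im| + 4)) := by
      rw [div_le_iff₀ hσ]
      have h12 : ‖s‖ * ‖s - 1‖ ≤ (|s.im| + 4) * (|s.im| + 4) :=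
        mul_le_mul hns hns1 (norm_nonneg _) (by positivity)
      have : (1 : ℝ) ≤ 2 * s.re := by linarith
      nlinarith [h12, mul_nonneg (norm_nonneg s) (norm_nonneg (s - 1))]
    rw [Real.rpow_two]
    calc ‖riemannZeta₁ s‖ ≤ ‖s‖ + ‖s‖ * ‖s - 1‖ / s.re := hmain
      _ ≤ (|s.im| + 4) + 2 * ((|s.im| + 4) * (|s.im| + 4)) := add_le_add hns hdiv
      _ ≤ 3 * (|s.im| + 4) ^ 2 := by nlinarith

/-! ## rh.S09 -/

/-- The change of coordinates between `log(|t| + 4)` (Montgomery–Vaughan's `log τ`) and `log|t|`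
(rh.S09): for `|t| ≥ 2`, `log(|t| + 4) < 3 log|t|`, because `|t| + 4 < |t|³`. [folklore] -/
theorem log_abs_add_four_lt {t : ℝ} (ht : 2 ≤ |t|) : Real.log (|t| + 4) < 3 * Real.log |t| := by
  have h3 : Real.log (|t| ^ 3) = 3 * Real.log |t| := by
    rw [Real.log_pow]
    norm_num
  rw [← h3]
  apply Real.log_lt_log (by positivity)
  have h0 : 0 ≤ |t| := abs_nonneg t
  have h1 : 4 ≤ |t| * |t| := by nlinarith
  have h2 : 4 * |t| ≤ |t| * |t| * |t| := mul_le_mul_of_nonneg_right h1 h0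
  have h4 : |t| ^ 3 = |t| * |t| * |t| := by ring
  rw [h4]
  linarith

/-- For `|t| ≥ 2`, `log|t| ≥ log 2 > 0`. [folklore] -/
theorem log_abs_pos_of_two_le {t : ℝ} (ht : 2 ≤ |t|) : 0 < Real.log |t| :=
  (Real.log_pos one_lt_two).trans_le (Real.log_le_log two_pos ht)

/-- From a Montgomery–Vaughan-style constant `c₀` (region `σ > 1 − c₀/log(|t| + 4)`, `σ > 1/2`) to
an rh.S09-style constant: with `c = min (c₀/3) (log 2/4)`, every `σ ≥ 1 − c/log|t|`, `|t| ≥ 2`,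
satisfies `σ > 1/2` and `σ > 1 − c₀/log(|t| + 4)`. [folklore] -/
theorem region_of_le {c₀ σ t : ℝ} (hc₀ : 0 < c₀) (ht : 2 ≤ |t|)
    (hσ : 1 - min (c₀ / 3) (Real.log 2 / 4) / Real.log |t| ≤ σ) :
    1 / 2 < σ ∧ 1 - c₀ / Real.log (|t| + 4) < σ := by
  set c : ℝ := min (c₀ / 3) (Real.log 2 / 4) with hcdef
  have hlog2 : 0 < Real.log 2 := Real.log_pos one_lt_two
  have hlogt : Real.log 2 ≤ Real.log |t| := Real.log_le_log two_pos ht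
  have hlogt_pos : 0 < Real.log |t| := hlog2.trans_le hlogt
  have hlogτ_pos : 0 < Real.log (|t| + 4) := Real.log_pos (by linarith)
  have hc3 : c ≤ c₀ / 3 := min_le_left _ _
  have hc4 : c ≤ Real.log 2 / 4 := min_le_right _ _
  have hcpos : 0 < c := lt_min (by positivity) (by positivity)
  constructor
  · -- `c / log|t| ≤ (log 2/4)/log 2 = 1/4`
    have h1 : c / Real.log |t| ≤ 1 / 4 := by
      rw [div_le_iff₀ hlogt_pos]
      linarith
    linarith
  · -- `c / log|t| ≤ c₀/(3 log|t|) < c₀ / log(|t| + 4)`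
    have hlt := log_abs_add_four_lt ht
    have h1 : c / Real.log |t| < c₀ / Real.log (|t| + 4) := by
      rw [div_lt_div_iff₀ hlogt_pos hlogτ_pos]
      calc c * Real.log (|t| + 4) ≤ c₀ / 3 * Real.log (|t| + 4) := by gcongr
        _ < c₀ / 3 * (3 * Real.log |t|) := by gcongr
        _ = c₀ * Real.log |t| := by ring
    linarith

/-- A point `σ + it` with `|t| ≥ 2` is not the pole `s = 1`. [folklore] -/
theorem ofReal_add_mul_I_ne_one {σ t : ℝ} (ht : 2 ≤ |t|) : (σ + t * I : ℂ) ≠ 1 := by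
  intro h
  have := congrArg Complex.im h
  simp at this
  rw [this, abs_zero] at ht
  linarith

/-- **rh.S09, de la Vallée Poussin's zero-free region, PROVED** (discharging the named fact
`Literature.NumberTheory.LFunctions.zero_free_region_classical` of `RHWave0.lean`): there is an absolute constant `c > 0` with
`ζ(σ + it) ≠ 0` for `|t| ≥ 2`, `σ ≥ 1 − c/log|t|`. Proof: `ClassicalZFRData.zeroFree`
(Montgomery–Vaughan Theorem 6.6, via Titchmarsh's Lemma α) for the data
`classicalZFRData_riemannZeta`, and the change of constant `region_of_le`.
[cite: Poussin1899] [cite: MontgomeryVaughan2007, Theorem 6.6]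
[cite: Titchmarsh1986, Theorem 3.8] -/
theorem zero_free_region_classical_holds : zero_free_region_classical := by
  obtain ⟨c₀, hc₀, hzf⟩ := classicalZFRData_riemannZeta.zeroFree
  refine ⟨min (c₀ / 3) (Real.log 2 / 4), lt_min (by positivity)
    (by have := Real.log_pos one_lt_two; positivity), fun σ t ht hσ hzero ↦ ?_⟩
  obtain ⟨hhalf, hreg⟩ := region_of_le hc₀ ht hσ
  have hs1 := ofReal_add_mul_I_ne_one (σ := σ) ht
  exact hzf (σ + t * I) (by simp; linarith) (by simpa using hreg)
    ((riemannZeta₁_eq_zero_iff hs1).mpr hzero)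

/-- **The logarithmic derivative in the zero-free region** (Montgomery–Vaughan Theorem 6.7 for
`ζ`, in the coordinates of rh.S09): there are absolute constants `c > 0`, `C ≥ 0` such that for
`|t| ≥ 2` and `σ ≥ 1 − c/log|t|`, `ζ(σ + it) ≠ 0` and `|ζ'/ζ(σ + it)| ≤ C log|t|`.
From `ClassicalZFRData.norm_logDeriv_le` for `classicalZFRData_riemannZeta`:
`ζ'/ζ = ζ₁'/ζ₁ − 1/(s − 1)`, `|1/(s − 1)| ≤ 1/|t| ≤ 1/2 ≤ log|t|`, `log(|t| + 4) < 3 log|t|`.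
[cite: MontgomeryVaughan2007, Theorem 6.7] [cite: Titchmarsh1986, Theorem 3.11 (3.11.7)] -/
theorem exists_norm_logDeriv_riemannZeta_le :
    ∃ c : ℝ, 0 < c ∧ ∃ C : ℝ, 0 ≤ C ∧ ∀ σ t : ℝ, 2 ≤ |t| → 1 - c / Real.log |t| ≤ σ →
      riemannZeta (σ + t * I) ≠ 0 ∧
        ‖deriv riemannZeta (σ + t * I) / riemannZeta (σ + t * I)‖ ≤ C * Real.log |t| := by
  obtain ⟨c₀, hc₀, C₀, hC₀, hld⟩ := classicalZFRData_riemannZeta.norm_logDeriv_le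
  refine ⟨min (c₀ / 3) (Real.log 2 / 4), lt_min (by positivity)
    (by have := Real.log_pos one_lt_two; positivity), 3 * C₀ + 1, by positivity, fun σ t ht hσ ↦ ?_⟩
  obtain ⟨hhalf, hreg⟩ := region_of_le hc₀ ht hσ
  have hs1 := ofReal_add_mul_I_ne_one (σ := σ) ht
  set s : ℂ := σ + t * I with hsdef
  have hsre : s.re = σ := by simp [hsdef]
  have hsim : s.im = t := by simp [hsdef]
  obtain ⟨hne₁, hbd⟩ := hld s (by rw [hsre]; linarith) (by rw [hsre, hsim]; exact hreg.le)
  have hζ : riemannZeta s ≠ 0 := fun hzero ↦ hne₁ ((riemannZeta₁_eq_zero_iff hs1).mpr hzero)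
  refine ⟨hζ, ?_⟩
  have hlogt_pos : 0 < Real.log |t| := log_abs_pos_of_two_le ht
  have hlog2 : (0.6931471803 : ℝ) < Real.log 2 := Real.log_two_gt_d9
  have hlogt2 : Real.log 2 ≤ Real.log |t| := Real.log_le_log two_pos ht
  -- `ζ'/ζ(s) = ζ₁'/ζ₁(s) − 1/(s − 1)` (`Literature.NumberTheory.LFunctions.logDeriv_riemannZeta_eq`)
  have hdecomp : deriv riemannZeta s / riemannZeta s =
      deriv riemannZeta₁ s / riemannZeta₁ s - 1 / (s - 1) := by
    rw [← logDeriv_apply, ← logDeriv_apply, logDeriv_riemannZeta_eq hs1 hζ, one_div]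
  -- `|1/(s − 1)| ≤ 1/|t| ≤ 1/2`
  have hinv : ‖1 / (s - 1)‖ ≤ Real.log |t| := by
    rw [norm_div, norm_one]
    have him : |t| ≤ ‖s - 1‖ := by
      have := Complex.abs_im_le_norm (s - 1)
      simpa [hsim] using this
    have h1 : 1 / ‖s - 1‖ ≤ 1 / 2 := by
      rw [div_le_div_iff₀ (by linarith) two_pos]
      linarith
    linarith
  have hlt := log_abs_add_four_lt ht
  calc ‖deriv riemannZeta s / riemannZeta s‖
      = ‖deriv riemannZeta₁ s / riemannZeta₁ s - 1 / (s - 1)‖ := by rw [hdecomp]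
    _ ≤ ‖deriv riemannZeta₁ s / riemannZeta₁ s‖ + ‖1 / (s - 1)‖ := norm_sub_le _ _
    _ ≤ C₀ * Real.log (|s.im| + 4) + Real.log |t| := add_le_add hbd hinv
    _ ≤ C₀ * (3 * Real.log |t|) + Real.log |t| := by rw [hsim]; gcongr
    _ = (3 * C₀ + 1) * Real.log |t| := by ring

end Literature.NumberTheory.LFunctions

end
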